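import Summits.CriticalPhenomena.CardyFormulaZ2.Theorems.CardySusyWardParafermionFamiliesToSLESixTouchLowerBoundG
import Literature.Probability.Percolation.BoxCrossingLowerBound
import Literature.Probability.LatticeModels.BoundaryValues

/-!
# Touch lower bound on diagonal free walls (stub `stub_touchLowerBound`, reshape r2, of the line
# `exact-potential-schwarz-christoffel`, crux stmt-CriticalPhenomena-10814), H: inputs of the gluing

Helper file for the GLUING half of `stub_touchLowerBound` (joining the far end of the wall arm to the discrete
wired arc `zdArcA` through the bulk of the polygon, uniformly in the mesh): the `ω`-free inputs.

* `mem_openConnIn_restrict`, `mem_openCircuitAroundAt_restrict`, `mem_lrCrossingAt_restrict`: an open crossing /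
  circuit event whose region avoids a set of sites is an event of the configuration RESTRICTED to the edges off that
  set (used with the set `zdArcB`, whose edges the boundary condition closes);
* `dist_meshPoint_le_of_abs_le`, `dist_le_level_add_column`, `band_finite'`: lattice bookkeeping;
* `exists_chainData_of_mem`: tube data from an INTERIOR point `c₀` of a marked Jordan domain to an interior point
  of a prescribed boundary arc (a boundary point `a'` isolated in the arc at radius `2r`, `10 r ≤ dist a' c₀`, a chain
  of centres `c 0 = c₀, …, c N` with `dist (c N) a' < r/40`, steps `≤ s/100`, closed `s`-balls inside the domain,
  `s ≤ r/40`, `r ≤ r₁`) — the template is `exists_chainData` of `BoxCrossingLowerBound.lean`;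
* `eventually_not_mem_zdArcB`: along a discretisation family, the sites whose mesh points lie in a compact set
  missing the arc `P.arc 1` are eventually off the discrete arc `zdArcB` (Hausdorff convergence of the label sets,
  `exists_frontier_near_of_mem_zdBoundary₀`).
-/

noncomputable section

namespace Summit.CriticalPhenomena.CardyFormulaZ2.Theorems.ParafermionFamiliesToSLESix.TouchLowerBound

open Set Metric Complex Filter MeasureTheory
open scoped Topology ENNReal
open Literature.Probability.LatticeModels Literature.Probability.Percolation
open Literature.Probability.RandomPlanarGeometry
open Summit.CriticalPhenomena.CardyFormulaZ2.Theorems.ParafermionPrecompact.Negative (IsFamily)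

/-! ## Restricting a configuration to the edges off a set of sites -/

/-- **Restricted connections.** If `x ↔ y` inside `S` by `ω`-open edges and every site of `S` satisfies `Q`, then
`x ↔ y` inside `S` by open edges of the restricted configuration `{e ∈ ω | ∀ v ∈ e, Q v}`. [folklore] -/
theorem mem_openConnIn_restrict {ω : BondConfig (Site 2)} {Q : Site 2 → Prop} {S : Set (Site 2)}
    (hS : ∀ v ∈ S, Q v) {x y : Site 2} (h : ω ∈ openConnIn S x y) :
    {e | e ∈ ω ∧ ∀ v ∈ e, Q v} ∈ openConnIn S x y := by
  obtain ⟨hx, hy, hr⟩ := h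
  let φ : (openGraph ω).induce S →g (openGraph {e | e ∈ ω ∧ ∀ v ∈ e, Q v}).induce S :=
    { toFun := id
      map_rel' := by
        intro u v huv
        rw [SimpleGraph.induce_adj, openGraph_adj] at huv
        change (openGraph {e | e ∈ ω ∧ ∀ v ∈ e, Q v}).Adj u.1 v.1
        rw [openGraph_adj]
        refine ⟨⟨huv.1, fun w hw => ?_⟩, huv.2⟩
        rcases Sym2.mem_iff.1 hw with rfl | rfl
        exacts [hS _ u.2, hS _ v.2] }
  exact ⟨hx, hy, hr.map φ⟩

/-- **Restricted circuits.** An open circuit of `v + A(l)` whose sites (all within `3√2 l δ` of `δ v` at mesh `δ`)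
satisfy `Q` is an open circuit of the restricted configuration. [folklore] -/
theorem mem_openCircuitAroundAt_restrict {δ : ℝ} (hδ : 0 < δ) {ω : BondConfig (Site 2)} {Q : Site 2 → Prop}
    {v : Site 2} {l : ℕ}
    (hQ : ∀ x : Site 2, dist (meshPoint δ x) (meshPoint δ v) ≤ 3 * Real.sqrt 2 * l * δ → Q x)
    (h : ω ∈ openCircuitAroundAt v l) : {e | e ∈ ω ∧ ∀ y ∈ e, Q y} ∈ openCircuitAroundAt v l := by
  obtain ⟨u, w, hc, hs, he, ho⟩ := h
  refine ⟨u, w, hc, hs, fun e he' => ⟨he e he', fun y hy => hQ y ?_⟩, ho⟩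
  exact dist_meshPoint_le_of_mem_support hδ hc.not_nil hs (w.mem_support_of_mem_edges he' hy)

/-- **Restricted rectangle crossings.** An open left-right crossing of `u + [0, M] × [0, n]` whose sites satisfy
`Q` is a crossing of the restricted configuration. [folklore] -/
theorem mem_lrCrossingAt_restrict {ω : BondConfig (Site 2)} {Q : Site 2 → Prop} {u : Site 2} {M n : ℕ}
    (hQ : ∀ z : Site 2, u 0 ≤ z 0 → z 0 ≤ u 0 + M → u 1 ≤ z 1 → z 1 ≤ u 1 + n → Q z)
    (h : ω ∈ lrCrossingAt u M n) : {e | e ∈ ω ∧ ∀ y ∈ e, Q y} ∈ lrCrossingAt u M n := by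
  obtain ⟨x, hx, y, hy, hxy⟩ := h
  refine ⟨x, hx, y, hy, mem_openConnIn_restrict (fun z hz => ?_) hxy⟩
  obtain ⟨h1, h2, h3, h4⟩ := mem_image_rectangle_iff.1 hz
  exact hQ z h1 h2 h3 h4

/-! ## Lattice bookkeeping -/

/-- Mesh points of lattice points that are close in each coordinate are close. [folklore] -/
theorem dist_meshPoint_le_of_abs_le {δ : ℝ} (hδ : 0 ≤ δ) {x y : Site 2} {M₀ M₁ : ℤ} (h0 : |x 0 - y 0| ≤ M₀)
    (h1 : |x 1 - y 1| ≤ M₁) : dist (meshPoint δ x) (meshPoint δ y) ≤ ((M₀ : ℝ) + M₁) * δ := by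
  rw [dist_meshPoint_meshPoint hδ]
  have h := Complex.norm_le_abs_re_add_abs_im (Site.toComplex x - Site.toComplex y)
  simp only [sub_re, sub_im, Site.toComplex_re, Site.toComplex_im] at h
  have h0' : |((x 0 : ℤ) : ℝ) - ((y 0 : ℤ) : ℝ)| ≤ (M₀ : ℝ) := by exact_mod_cast h0
  have h1' : |((x 1 : ℤ) : ℝ) - ((y 1 : ℤ) : ℝ)| ≤ (M₁ : ℝ) := by exact_mod_cast h1
  calc δ * ‖Site.toComplex x - Site.toComplex y‖ ≤ δ * ((M₀ : ℝ) + M₁) :=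
        mul_le_mul_of_nonneg_left (by linarith) hδ
    _ = ((M₀ : ℝ) + M₁) * δ := by ring

/-- **Distances are controlled by level and column**: `dist p q ≤ |Δ level| + |Δ column|`. [folklore] -/
theorem dist_le_level_add_column {a b : ℤ} (ha : a = 1 ∨ a = -1) (hb : b = 1 ∨ b = -1) (p q : ℂ) :
    dist p q ≤ |((a : ℝ) * p.re + b * p.im) - ((a : ℝ) * q.re + b * q.im)| +
      |((a : ℝ) * p.re - b * p.im) - ((a : ℝ) * q.re - b * q.im)| := by
  rw [Complex.dist_eq]
  have h := norm_le_column_add_level ha hb (p - q)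
  have e1 : (a : ℝ) * (p - q).re - b * (p - q).im = ((a : ℝ) * p.re - b * p.im) - ((a : ℝ) * q.re - b * q.im) := by
    simp only [sub_re, sub_im]; ring
  have e2 : (a : ℝ) * (p - q).re + b * (p - q).im = ((a : ℝ) * p.re + b * p.im) - ((a : ℝ) * q.re + b * q.im) := by
    simp only [sub_re, sub_im]; ring
  rw [e1, e2] at h
  linarith

/-- The map `v ↦ (column, level)` is injective for signs `a, b = ±1`. [folklore] -/
theorem levelColumn_injective {a b : ℤ} (ha : a = 1 ∨ a = -1) (hb : b = 1 ∨ b = -1) :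
    Function.Injective fun v : Site 2 => (a * v 0 - b * v 1, a * v 0 + b * v 1) := by
  intro v w hvw
  simp only [Prod.mk.injEq] at hvw
  obtain ⟨h1, h2⟩ := hvw
  ext i
  fin_cases i
  · show v 0 = w 0
    rcases ha with rfl | rfl <;> rcases hb with rfl | rfl <;> omega
  · show v 1 = w 1
    rcases ha with rfl | rfl <;> rcases hb with rfl | rfl <;> omega

/-- **A band of bounded column and level is finite.** [folklore] -/
theorem band_finite' {a b : ℤ} (ha : a = 1 ∨ a = -1) (hb : b = 1 ∨ b = -1) (T : ℤ) (r : ℕ) (ℓ₁ ℓ₂ : ℤ) :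
    {v : Site 2 | |(a * v 0 - b * v 1) - T| ≤ r ∧ ℓ₁ ≤ a * v 0 + b * v 1 ∧ a * v 0 + b * v 1 ≤ ℓ₂}.Finite := by
  refine (HalfPlaneArm.box_finite (X := fun v : Site 2 => a * v 0 - b * v 1) (Y := fun v : Site 2 => a * v 0 + b * v 1)
    (levelColumn_injective ha hb) (T - r) (T + r) ℓ₁ ℓ₂).subset fun v hv => ?_
  obtain ⟨h1, h2, h3⟩ := hv
  rw [abs_le] at h1
  show T - r ≤ a * v 0 - b * v 1 ∧ a * v 0 - b * v 1 ≤ T + r ∧ ℓ₁ ≤ a * v 0 + b * v 1 ∧ a * v 0 + b * v 1 ≤ ℓ₂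
  exact ⟨by omega, by omega, h2, h3⟩

/-! ## Tube data from an interior point to a boundary arc -/

/-- **Tube data from an interior point.** In a marked Jordan domain `R`, for an interior point `c₀`, an arc
`arc i` and a bound `r₁ > 0` there are: a boundary point `a'` strictly inside `arc i`, a radius `0 < r ≤ r₁`
isolating it at scale `2r` (`∂Ω ∩ B(a', 2r) ⊆ arc i`, the other arcs at distance `≥ 2r`) with `10 r ≤ dist a' c₀`,
and a finite chain of points `c 0 = c₀, c 1, …, c N` of `Ω` ending within `r/40` of `a'`, consecutive points
within `s/100`, each with `closedBall (c k) s ⊆ Ω`, for some `0 < s ≤ r/40` (a path of the domain from `c₀` to an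
interior point near `a'`, sampled by uniform continuity, with `s` below its distance to `∂Ω`). The template is
`exists_chainData` (`BoxCrossingLowerBound.lean`). [folklore] -/
theorem exists_chainData_of_mem {n : ℕ} [NeZero n] (R : MarkedDomain n) (i : Fin n) {c₀ : ℂ}
    (hc₀ : c₀ ∈ R.carrier) {r₁ : ℝ} (hr₁ : 0 < r₁) :
    ∃ (a' : ℂ) (r s : ℝ) (N : ℕ) (c : ℕ → ℂ),
      0 < r ∧ 0 < s ∧ s ≤ r / 40 ∧ r ≤ r₁ ∧ a' ∈ frontier R.carrier ∧
      (∀ z ∈ frontier R.carrier, dist z a' < 2 * r → z ∈ R.arc i) ∧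
      (∀ j, j ≠ i → ∀ z ∈ R.arc j, 2 * r ≤ dist z a') ∧
      10 * r ≤ dist a' c₀ ∧ c 0 = c₀ ∧ dist (c N) a' < r / 40 ∧
      (∀ k < N, dist (c k) (c (k + 1)) ≤ s / 100) ∧
      (∀ k ≤ N, closedBall (c k) s ⊆ R.carrier) := by
  have h0 := R.midpoint_mem_Ioo i
  set a' := R.boundary ((R.mark i + R.nextMark i) / 2) with ha'
  obtain ⟨r₀, hr₀, hr₀a, hr₀a'⟩ := R.exists_pos_forall_mem_arc_of_dist_lt i h0
  have ha'arc : a' ∈ R.arc i := mem_image_of_mem _ (Ioo_subset_Icc_self h0)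
  have ha'fr : a' ∈ frontier R.carrier := R.boundary_mem_frontier _
  have hac₀ : 0 < dist a' c₀ := by
    rw [dist_pos]
    rintro h
    have h' := ha'fr
    rw [frontier, R.isOpen.interior_eq, h] at h'
    exact h'.2 hc₀
  set r := min (min (r₀ / 2) (dist a' c₀ / 10)) r₁ with hr
  have hrpos : 0 < r := lt_min (lt_min (by positivity) (by positivity)) hr₁
  have hr₀le : 2 * r ≤ r₀ := by
    have : r ≤ r₀ / 2 := (min_le_left _ _).trans (min_le_left _ _)
    linarith
  have hrd : r ≤ dist a' c₀ / 10 := (min_le_left _ _).trans (min_le_right _ _)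
  have hrr₁ : r ≤ r₁ := min_le_right _ _
  -- an interior point near `a'` and a path of `Ω` from `c₀` to it
  obtain ⟨z₂, hz₂, hz₂a⟩ := R.exists_mem_carrier_dist_lt i ha'arc (ε := r / 40) (by positivity)
  have hpc : IsPathConnected R.carrier :=
    (R.isOpen.isConnected_iff_isPathConnected).1 R.isConnected
  have hJ : JoinedIn R.carrier c₀ z₂ := hpc.joinedIn c₀ hc₀ z₂ hz₂
  set γ : Path c₀ z₂ := hJ.somePath with hγ
  have hγΩ : ∀ t, γ t ∈ R.carrier := hJ.somePath_mem
  -- margin to the boundary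
  obtain ⟨w₀, hw₀, hw₀γ⟩ := exists_pos_forall_lt_infDist (isCompact_range γ.continuous)
    (isClosed_compl_iff.2 R.isOpen)
    (disjoint_left.2 (by rintro _ ⟨t, rfl⟩ h; exact h (hγΩ t)))
    (nonempty_compl.2 R.carrier_ne_univ)
  set s := min w₀ (r / 40) with hs
  have hspos : 0 < s := lt_min hw₀ (by positivity)
  have hsw₀ : s ≤ w₀ := min_le_left _ _
  have hsr : s ≤ r / 40 := min_le_right _ _
  -- uniform continuity of the path
  have huc : UniformContinuousOn γ.extend (Icc 0 1) :=
    isCompact_Icc.uniformContinuousOn_of_continuous γ.continuous_extend.continuousOn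
  obtain ⟨η, hη, hηγ⟩ := Metric.uniformContinuousOn_iff.1 huc (s / 100) (by positivity)
  set N : ℕ := ⌊1 / η⌋₊ + 1 with hN
  have hN1 : 1 / η < N := by rw [hN]; push_cast; exact Nat.lt_floor_add_one _
  have hNpos : (0 : ℝ) < N := lt_trans (by positivity) hN1
  have hN1' : 1 / (N : ℝ) < η := by
    rw [div_lt_iff₀ hNpos]; rw [div_lt_iff₀ hη] at hN1; linarith
  set c : ℕ → ℂ := fun k => γ.extend (k / N) with hc
  have hcrange : ∀ k, c k ∈ range γ := fun k => by
    rw [← γ.extend_range]; exact mem_range_self _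
  refine ⟨a', r, s, N, c, hrpos, hspos, hsr, hrr₁, ha'fr, fun z hz hza => hr₀a z hz (hza.trans_le hr₀le),
    fun j hj z hz => hr₀le.trans (hr₀a' j hj z hz), by linarith [mul_le_mul_of_nonneg_left hrd (by norm_num : (0:ℝ) ≤ 10)],
    by simp [hc], ?_, ?_, ?_⟩
  · -- `c N = z₂`
    have : c N = z₂ := by
      simp only [hc]
      rw [div_self hNpos.ne', Path.extend_one]
    rw [this]; exact hz₂a
  · intro k hk
    have hk0 : (0 : ℝ) ≤ k / N := by positivity
    have hk1 : (k : ℝ) / N ≤ 1 := by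
      rw [div_le_one hNpos]; exact_mod_cast hk.le
    have hk0' : (0 : ℝ) ≤ (k + 1 : ℕ) / N := by positivity
    have hk1' : ((k + 1 : ℕ) : ℝ) / N ≤ 1 := by
      rw [div_le_one hNpos]; exact_mod_cast hk
    have hd : dist ((k : ℝ) / N) (((k + 1 : ℕ) : ℝ) / N) < η := by
      rw [Real.dist_eq]
      have : (k : ℝ) / N - ((k + 1 : ℕ) : ℝ) / N = -(1 / N) := by push_cast; ring
      rw [this, abs_neg, abs_of_pos (by positivity)]
      exact hN1'
    have := hηγ _ ⟨hk0, hk1⟩ _ ⟨hk0', hk1'⟩ hd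
    exact this.le
  · intro k _ z hz
    have h1 : w₀ < infDist (c k) R.carrierᶜ := hw₀γ _ (hcrange k)
    by_contra hzΩ
    have := notMem_of_dist_lt_infDist (x := c k) (y := z) (s := R.carrierᶜ)
      (by rw [dist_comm]; linarith [mem_closedBall.1 hz])
    exact this hzΩ

/-! ## Along a family, compacts off the free arc carry no site of the discrete free arc -/

/-- **Sites over a compact set missing `P.arc 1` are eventually off `zdArcB`.** Along a discretisation family `Λ`
of `P` (the six `IsFamily` fields), for a compact `K` disjoint from the arc `P.arc 1`, eventually in the mesh no site
whose mesh point lies in `K` belongs to the discrete arc `(Λ δ).zdArcB`: such a site is within `2δ` of a frontier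
point, hence within `2δ` of the label set `(Λ δ).arcB`, which is Hausdorff-close to `P.arc 1`, while `K` stays at
positive distance from `P.arc 1`. [folklore] -/
theorem eventually_not_mem_zdArcB (P : DobrushinDomain) (Λ : ℝ → DiscreteDobrushin) (hΛ : IsFamily P Λ)
    {K : Set ℂ} (hK : IsCompact K) (hKd : Disjoint K (P.arc 1)) :
    ∀ᶠ δ in 𝓝[>] (0:ℝ), ∀ x : Site 2, meshPoint δ x ∈ K → x ∉ (Λ δ).zdArcB := by
  obtain ⟨hΩ, hδ', -, hB, -, -⟩ := hΛ
  have h1ne : (P.arc 1).Nonempty := ⟨_, P.pt_mem_arc_self 1⟩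
  obtain ⟨θ, hθ, hθK⟩ := exists_pos_forall_lt_infDist hK (P.isClosed_arc 1) hKd h1ne
  have hθ4 : (0 : ℝ≥0∞) < ENNReal.ofReal (θ / 4) := ENNReal.ofReal_pos.2 (by positivity)
  filter_upwards [hB.eventually (gt_mem_nhds hθ4), Ioo_mem_nhdsGT (show (0:ℝ) < θ / 8 by positivity)]
    with δ hBδ hδδ x hxK hxB
  obtain ⟨hδ, hδlt⟩ := hδδ
  have hEΩ : (Λ δ).Ω = P.carrier := hΩ δ
  have hEδ : (Λ δ).δ = δ := hδ' δ
  obtain ⟨z, hz, hzd⟩ := exists_frontier_near_of_mem_zdBoundary₀ (Dm := P.toJordanDomain) hEΩ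
    (by rw [hEδ]; exact hδ) ((Λ δ).zdArcB_subset_zdBoundary hxB)
  rw [hEδ] at hzd
  have h1 : infDist (meshPoint δ x) (Λ δ).arcB ≤ 2 * δ := by
    have := infDist_le_dist_of_mem_zdDiscreteArc (A' := (Λ δ).arcB) hxB (z := z) (by rw [hEΩ]; exact hz)
    rw [hEδ] at this
    rw [dist_comm] at hzd
    exact this.trans hzd
  have hBne : (Λ δ).arcB.Nonempty :=
    nonempty_of_hausdorffEDist_ne_top h1ne (by rw [hausdorffEDist_comm]; exact ne_top_of_lt hBδ)
  obtain ⟨y, hy, hyd⟩ := (infDist_lt_iff hBne).1 (h1.trans_lt (by linarith : 2 * δ < 3 * δ))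
  obtain ⟨y', hy', hyy'⟩ := exists_edist_lt_of_hausdorffEDist_lt hy hBδ
  rw [edist_lt_ofReal] at hyy'
  have h2 : θ < infDist (meshPoint δ x) (P.arc 1) := hθK _ hxK
  have h3 : infDist (meshPoint δ x) (P.arc 1) ≤ dist (meshPoint δ x) y' := infDist_le_dist_of_mem hy'
  linarith [dist_triangle (meshPoint δ x) y y']

/-- **Registered one-line ticket `stub_touch_glueH`** (helper H of `stub_touchLowerBound`): distances are controlled
by the diagonal level and column. [folklore] -/
theorem stub_touch_glueH : ∀ (a b : ℤ), (a = 1 ∨ a = -1) → (b = 1 ∨ b = -1) → ∀ (p q : ℂ), dist p q ≤ |((a : ℝ) * p.re + b * p.im) - ((a : ℝ) * q.re + b * q.im)| + |((a : ℝ) * p.re - b * p.im) - ((a : ℝ) * q.re - b * q.im)| :=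
  fun _ _ ha hb p q => dist_le_level_add_column ha hb p q

end Summit.CriticalPhenomena.CardyFormulaZ2.Theorems.ParafermionFamiliesToSLESix.TouchLowerBound

end
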